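import Summits.KontsevichZagierPeriods.KontsevichZagierPeriods.Theorems.MzvKernelInKZTwoPosetsEdsCertificateLow

/-!
# Crux `LinRedNormalForm.HoffmanSpanInKZ` (stmt-KontsevichZagierPeriods-15044), line `Sketch`:
# a linear-time zero test for certificate tables (registered stub `stub_certCheck`)

The per-weight EDS certificate tables of `MzvKernelInKZTwoPosetsEdsCertificateLow` are checked by
the kernel through `Cert.ok`, whose last conjunct `FVec.isZero` recomputes the total coefficient of
every occurring word — quadratic in the length of the formal expansion (`≈ 300` at weight `7`,
`≈ 2000` at weight `9`). This file replaces it by a radix test `zeroTest`: split the expansion by the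
first letter (`splitFV`, one structural pass), check that the words exhausted at this level have
total coefficient `0`, and recurse on the two tails — `N` passes in weight `N`. Soundness
(`eval_eq_zero_of_zeroTest`, through the prefix-generalised realisation `evalP`), the
checker `certOk₂` and the table lemma `edsCertificate_of_table₂` mirror `Cert.sound` /
`edsCertificate_of_table`; they are what the weight `8, 9, 10` tables of the skeleton
(`Cruxes/HoffmanSpanInKZ/Lines/Sketch.lean`, stubs `stub_eds8 … stub_eds10`) are checked with.

Sources: K. Ihara, M. Kaneko, D. Zagier, Compos. Math. 142 (2006), §1 (the relation families);
the reflection set-up is that of `MzvKernelInKZTwoPosetsEdsCertificateLow` (this tree).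
-/

namespace Summit.KontsevichZagierPeriods.LinRedNormalForm.HoffmanSpanInKZ

open Literature.NumberTheory.Transcendental
open Summit.KontsevichZagierPeriods.MzvKernelInKZ.Negative
open Summit.KontsevichZagierPeriods.MzvKernelInKZ.TwoPosets

/-! ## The radix split and the zero test -/

/-- One structural pass over a formal combination: the total coefficient of the empty word, the
tails of the words starting with `false`, the tails of the words starting with `true`. [folklore] -/
def splitFV : FVec → ℚ × FVec × FVec
  | [] => (0, [], [])
  | ([], c) :: v => ((splitFV v).1 + c, (splitFV v).2.1, (splitFV v).2.2)
  | (false :: t, c) :: v => ((splitFV v).1, (t, c) :: (splitFV v).2.1, (splitFV v).2.2)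
  | (true :: t, c) :: v => ((splitFV v).1, (splitFV v).2.1, (t, c) :: (splitFV v).2.2)

/-- The radix zero test with fuel `n` (use `n =` the common word length): every word has total
coefficient `0`. Linear in the length of the combination per level. [folklore] -/
def zeroTest : ℕ → FVec → Bool
  | 0, v => decide ((splitFV v).1 = 0) && (splitFV v).2.1.isEmpty && (splitFV v).2.2.isEmpty
  | n + 1, v => decide ((splitFV v).1 = 0) && zeroTest n (splitFV v).2.1 && zeroTest n (splitFV v).2.2

/-- Prefix-generalised realisation: the word `p.1` is read after the prefix `pre`. [folklore] -/
def evalP (N : ℕ) (pre : List Bool) (v : FVec) : Vec N :=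
  (v.map fun p => p.2 • unitVec N (wordOf N (pre ++ p.1))).sum

/-- At the empty prefix the generalised realisation is the realisation. [folklore] -/
theorem evalP_nil (N : ℕ) (v : FVec) : evalP N [] v = FVec.eval N v := by
  simp [evalP, FVec.eval]

/-- Realisation of the empty combination. [folklore] -/
@[simp] theorem evalP_nil_list (N : ℕ) (pre : List Bool) : evalP N pre [] = 0 := by
  simp [evalP]

/-- Realisation of a combination with a leading term. [folklore] -/
@[simp] theorem evalP_cons (N : ℕ) (pre : List Bool) (p : List Bool × ℚ) (v : FVec) :
    evalP N pre (p :: v) = p.2 • unitVec N (wordOf N (pre ++ p.1)) + evalP N pre v := by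
  simp [evalP]

/-- **The split is exact**: the realisation after a prefix is the empty-word part plus the two
tail parts read after the extended prefixes. [folklore] -/
theorem evalP_split (N : ℕ) (pre : List Bool) (v : FVec) :
    evalP N pre v = (splitFV v).1 • unitVec N (wordOf N pre) +
      evalP N (pre ++ [false]) (splitFV v).2.1 + evalP N (pre ++ [true]) (splitFV v).2.2 := by
  induction v with
  | nil => simp [splitFV]
  | cons p v ih =>
    obtain ⟨w, c⟩ := p
    match w with
    | [] =>
      simp only [evalP_cons, List.append_nil, splitFV, ih, add_smul]
      abel
    | false :: t =>
      simp only [evalP_cons, splitFV, ih, List.append_assoc, List.singleton_append]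
      abel
    | true :: t =>
      simp only [evalP_cons, splitFV, ih, List.append_assoc, List.singleton_append]
      abel

/-- **Soundness of the radix zero test** (prefix form). [folklore] -/
theorem evalP_eq_zero_of_zeroTest (N : ℕ) :
    ∀ (n : ℕ) (pre : List Bool) (v : FVec), zeroTest n v = true → evalP N pre v = 0 := by
  intro n
  induction n with
  | zero =>
    intro pre v h
    simp only [zeroTest, Bool.and_eq_true, decide_eq_true_eq, List.isEmpty_iff] at h
    obtain ⟨⟨h0, h1⟩, h2⟩ := h
    rw [evalP_split, h0, h1, h2]
    simp
  | succ n ih =>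
    intro pre v h
    simp only [zeroTest, Bool.and_eq_true, decide_eq_true_eq] at h
    obtain ⟨⟨h0, h1⟩, h2⟩ := h
    rw [evalP_split, h0, ih _ _ h1, ih _ _ h2]
    simp

/-- **Soundness of the radix zero test**: if `zeroTest n v` accepts, the realised vector vanishes
(in every length `N`). [folklore] -/
theorem eval_eq_zero_of_zeroTest (N : ℕ) {n : ℕ} {v : FVec} (h : zeroTest n v = true) :
    FVec.eval N v = 0 := by
  rw [← evalP_nil]
  exact evalP_eq_zero_of_zeroTest N n [] v h


/-! ## The checker with the radix test -/

/-- The checker of `MzvKernelInKZTwoPosetsEdsCertificateLow` with the quadratic `isZero` replaced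
by the radix test `zeroTest N`. [folklore] -/
def certOk₂ (N : ℕ) (c : Cert) : Bool :=
  decide (∀ p ∈ c.H, MZV.IsHoffman p.1 ∧ MZV.weight p.1 = N) &&
  decide (∀ p ∈ c.F, MZV.IsAdmissible p.1.1 ∧ MZV.IsAdmissible p.1.2 ∧ p.1.1 ≠ [] ∧ p.1.2 ≠ [] ∧
    MZV.weight p.1.1 + MZV.weight p.1.2 = N) &&
  decide (∀ p ∈ c.D, MZV.IsAdmissible p.1 ∧ MZV.weight p.1 + 1 = N) &&
  decide (∀ p ∈ c.K, Adm (bword N p.1)) && zeroTest N (c.fvec N)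

/-- **Soundness of the radix checker**: an accepted certificate proves the `EdsCertificate` clause
of its word. [folklore] -/
theorem certSound₂ (N : ℕ) (c : Cert) (h : certOk₂ N c = true) :
    ∃ (H : List (List ℕ × ℚ)) (F : List ((List ℕ × List ℕ) × ℚ)) (D : List (List ℕ × ℚ))
      (K : List ((Fin N → Bool) × ℚ)),
      (∀ p ∈ H, MZV.IsHoffman p.1 ∧ MZV.weight p.1 = N) ∧
      (∀ p ∈ F, MZV.IsAdmissible p.1.1 ∧ MZV.IsAdmissible p.1.2 ∧ p.1.1 ≠ [] ∧ p.1.2 ≠ [] ∧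
        MZV.weight p.1.1 + MZV.weight p.1.2 = N) ∧
      (∀ p ∈ D, MZV.IsAdmissible p.1 ∧ MZV.weight p.1 + 1 = N) ∧
      (∀ p ∈ K, Adm p.1) ∧
      unitVec N (bword N c.w) - (H.map fun p => p.2 • unitVec N (bword N p.1)).sum =
        (F.map fun p => p.2 • fdsVec N p.1.1 p.1.2).sum +
          (D.map fun p => p.2 • hoffmanVec N p.1).sum +
          (K.map fun p => p.2 • dualVec N p.1).sum := by
  simp only [certOk₂, Bool.and_eq_true, decide_eq_true_eq] at h
  obtain ⟨⟨⟨⟨hH, hF⟩, hD⟩, hK⟩, hz⟩ := h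
  refine ⟨c.H, c.F, c.D, c.K.map fun p => (bword N p.1, p.2), hH, hF, hD, ?_, ?_⟩
  · intro p hp
    obtain ⟨q, hq, rfl⟩ := List.mem_map.1 hp
    exact hK q hq
  · have h0 := eval_eq_zero_of_zeroTest N hz
    rw [Cert.eval_fvec, sub_eq_zero] at h0
    rw [h0, List.map_map]
    rfl


/-- **From a radix-checked table to `EdsCertificate N`.** [folklore] -/
theorem edsCertificate_of_table₂ (N : ℕ) (T : List Cert) (hT : T.all (certOk₂ N) = true)
    (hcover : ∀ ε : Fin N → Bool, Adm ε → ∃ c ∈ T, bword N c.w = ε) : EdsCertificate N := by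
  intro ε hε
  obtain ⟨c, hc, rfl⟩ := hcover ε hε
  exact certSound₂ N c (List.all_eq_true.1 hT c hc)

/-- A Boolean coverage test: every admissible word of length `N` is the word of some certificate
of the table (decided over the `2^N` words; stated separately so that tables split over several
`List.all` lemmas can share it). [folklore] -/
theorem cover_of_decide (N : ℕ) (T : List Cert)
    (h : decide (∀ ε : Fin N → Bool, Adm ε → ∃ c ∈ T, bword N c.w = ε) = true) :
    ∀ ε : Fin N → Bool, Adm ε → ∃ c ∈ T, bword N c.w = ε :=
  of_decide_eq_true h

/-! ## The registered stub -/

/-- Soundness of the radix zero test, as a statement: whenever `zeroTest n v` accepts, the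
realisation of `v` in every length vanishes (a statement about this file's own `zeroTest`; not a
published fact). -/
def CertCheckSound : Prop := ∀ (N n : ℕ) (v : FVec), zeroTest n v = true → FVec.eval N v = 0

/-- **Registered stub `stub_certCheck`** of the skeleton of line `Sketch`. -/
theorem stub_certCheck : CertCheckSound := fun N _ _ h => eval_eq_zero_of_zeroTest N h

/-- Smoke test: the weight-`4` table of `MzvKernelInKZTwoPosetsEdsCertificateLow` passes the radix
checker (kernel). [folklore] -/
example : (table 4).all (certOk₂ 4) = true := by decide +kernel

end Summit.KontsevichZagierPeriods.LinRedNormalForm.HoffmanSpanInKZ
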